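import Mathlib
import Summits.NavierStokesRegularity.NavierStokesRegularity.Theorems.FilamentSkeletonRssMatchedKernelPartnerStrain
import Summits.NavierStokesRegularity.NavierStokesRegularity.Theorems.FilamentSkeletonRssSelectionBoxRJRungNormalBlockTools

/-!
# Matched-core normal block, TOOLS: kernel facts with a core `q ∈ [m₁, m₂]` and the `m₁`-scaled two-region majorant

First file of the μ-parametrised port of the DETERMINANT half of clause 12 (`SelectionBoxRJRung.RungNormalBlock{Tools,Self,Det,Box}`,
lane 19175-p1 g8, unit core) to the matched kernel of the A1G cone (`SkeletonJ1G` stmt-27849 / `TransverseReduction1AG` stmt-27853; kit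
`retype_R-T_kit.md` §5(d): «1 ↦ μ² with μ² ∈ [μ_min², μ_max²] tracked through the constants»).  Pointwise along the filament the matched
kernel is `K_p(q; z) = ((‖z‖² + q)^{p/2})⁻¹` with a core constant `q = κ·Aa(σ)` confined to `[m₁, m₂]` on the near region; the unit-core
lemmas become:

* `kernel_le_core` — `K_p(q; z) ≤ (m₁^{p/2})⁻¹` for `q ≥ m₁ > 0`; `kernel3_ge_core` — `K₃(q; z) ≥ (1/3)(m₂^{3/2})⁻¹` for `‖z‖² ≤ m₂`,
  `0 < q ≤ m₂` (`2^{3/2} < 3`): the own core rotates at rate `≳ 1/m₂`;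
* `gradIntegrand_curv_le_core` / `gradIntegrand_turn_le_core` — the Region-A curvature (`K₅`) and turning (`K₃`) terms of the self-gradient are
  `≤ 192 κ₀ (m₁ + s²)⁻¹` and `≤ 32 κ₀ (m₁ + s²)⁻¹` (SAME constants as the unit core; the majorant is rescaled to the core: `(1 + s²)⁻¹ ↦
  (m₁ + s²)⁻¹`, integral `π ↦ π/√m₁`);
* `gradIntegrand_far_le_core` — Region B (far) is core-free: `‖z‖⁻³`-bounds for ANY `q ≥ 0` (via `MatchedKernel.matched_kernel_le_inv_pow`,
  `matched_gradIntegrand_norm_le`);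
* `coreRegion_majorant_integral`, `coreRegion_dominate` — `∫ (C_A (m₁ + (u − c)²)⁻¹ + C_B (1 + (k(u − c))²)⁻¹) = C_A π/√m₁ + C_B π/k`.

The kernel-free geometry (`tangent_sub_le`, `chord_sub_tangentLine_le`, `chord_le`, `inner_chord_normal_le`, `chord_ge_half`,
`cross_pairing_identities`, `norm_cross_le_one`, `cauchy_majorant_core`) is imported from the unit-core files unchanged.  Lane ns-filament-19175-p1
g11; `--supports stmt-NavierStokesRegularity-27849`.  HONEST FRAMING: kernel estimates about a HYPOTHETICAL filament skeleton on the NEGATIVE side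
of a MODEL route; nothing here bears on Navier–Stokes regularity or blow-up.
-/

set_option linter.dupNamespace false

noncomputable section

namespace Summit.NavierStokesRegularity.NavierStokesRegularity.Theorems.MatchedKernel

open Set Function Filter MeasureTheory Real
open Literature.Analysis.FluidPDE
open Summit.NavierStokesRegularity.NavierStokesRegularity.Theorems.SelectionBoxRJRung
open scoped InnerProductSpace Topology

/-! ### Kernel facts with a core constant `q` -/

/-- `K_p(q; r) = ((r² + q)^p)⁻¹ ≤ (m₁^p)⁻¹` and `0 ≤ K_p` for `0 < m₁ ≤ q`, `0 ≤ p`. [folklore] -/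
theorem kernel_le_core {m₁ q : ℝ} (hm₁ : 0 < m₁) (hq : m₁ ≤ q) (r p : ℝ) (hp : 0 ≤ p) :
    ((r ^ 2 + q) ^ p)⁻¹ ≤ (m₁ ^ p)⁻¹ ∧ 0 ≤ ((r ^ 2 + q) ^ p)⁻¹ := by
  have h1 : m₁ ^ p ≤ (r ^ 2 + q) ^ p := Real.rpow_le_rpow hm₁.le (by nlinarith [sq_nonneg r]) hp
  have hq0 : 0 ≤ r ^ 2 + q := by nlinarith [sq_nonneg r]
  exact ⟨inv_anti₀ (Real.rpow_pos_of_pos hm₁ p) h1, inv_nonneg.2 (Real.rpow_nonneg hq0 p)⟩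

/-- Near the diagonal the matched `K₃` kernel is bounded below by the core: `‖z‖² ≤ m₂`, `0 < q ≤ m₂` ⇒
`(1/3)(m₂^{3/2})⁻¹ ≤ ((‖z‖² + q)^{3/2})⁻¹` (`(2m₂)^{3/2} = 2^{3/2} m₂^{3/2} < 3 m₂^{3/2}`). [folklore] -/
theorem kernel3_ge_core {m₂ q r : ℝ} (hm₂ : 0 < m₂) (hq0 : 0 < q) (hq : q ≤ m₂) (hr : r ^ 2 ≤ m₂) :
    1 / 3 * (m₂ ^ (3 / 2 : ℝ))⁻¹ ≤ ((r ^ 2 + q) ^ (3 / 2 : ℝ))⁻¹ := by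
  have hpos : 0 < r ^ 2 + q := by nlinarith [sq_nonneg r]
  have h2 : (r ^ 2 + q) ^ (3 / 2 : ℝ) ≤ (2 * m₂) ^ (3 / 2 : ℝ) :=
    Real.rpow_le_rpow hpos.le (by linarith) (by norm_num)
  have h8 : ((2 : ℝ) ^ (3 / 2 : ℝ)) ^ 2 = 8 := by
    rw [← Real.rpow_natCast, ← Real.rpow_mul (by norm_num)]; norm_num
  have h3 : (2 : ℝ) ^ (3 / 2 : ℝ) < 3 := by
    nlinarith [Real.rpow_nonneg (show (0:ℝ) ≤ 2 by norm_num) (3 / 2 : ℝ)]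
  have hm32 : 0 < m₂ ^ (3 / 2 : ℝ) := Real.rpow_pos_of_pos hm₂ _
  have hsplit : (2 * m₂) ^ (3 / 2 : ℝ) = (2 : ℝ) ^ (3 / 2 : ℝ) * m₂ ^ (3 / 2 : ℝ) :=
    Real.mul_rpow (by norm_num) hm₂.le
  have h4 : (r ^ 2 + q) ^ (3 / 2 : ℝ) ≤ 3 * m₂ ^ (3 / 2 : ℝ) := by
    calc (r ^ 2 + q) ^ (3 / 2 : ℝ) ≤ (2 : ℝ) ^ (3 / 2 : ℝ) * m₂ ^ (3 / 2 : ℝ) := by rw [← hsplit]; exact h2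
      _ ≤ 3 * m₂ ^ (3 / 2 : ℝ) := mul_le_mul_of_nonneg_right h3.le hm32.le
  have hK : 0 < (r ^ 2 + q) ^ (3 / 2 : ℝ) := Real.rpow_pos_of_pos hpos _
  rw [show 1 / 3 * (m₂ ^ (3 / 2 : ℝ))⁻¹ = (3 * m₂ ^ (3 / 2 : ℝ))⁻¹ by rw [mul_inv]; norm_num]
  exact inv_anti₀ hK h4

/-! ### Region A (near the base point): curvature and turning terms with a core `q ≥ m₁` -/

/-- **Region A, curvature (`K₅`) term, matched core.**  With `‖T‖ ≤ 1`, `‖l‖ ≤ 1`, `|⟪z, h⟫| ≤ κ₀ s²`, `‖z‖ ≤ |s|`, `|s|/2 ≤ ‖z‖`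
(`κ₀ ≥ 0`) and a core constant `q ≥ m₁ > 0`: `|−3⟪z, h⟫K₅(q; z) ⟪T × z, l⟫| ≤ 192 κ₀ (m₁ + s²)⁻¹`. [folklore] -/
theorem gradIntegrand_curv_le_core {m₁ q : ℝ} (hm₁ : 0 < m₁) (hq : m₁ ≤ q) {T z h l : EuclideanSpace ℝ (Fin 3)} {s κ₀ : ℝ}
    (hT : ‖T‖ ≤ 1) (hl : ‖l‖ ≤ 1) (hκ : 0 ≤ κ₀) (hzh : |⟪z, h⟫_ℝ| ≤ κ₀ * s ^ 2) (hzle : ‖z‖ ≤ |s|) (hzge : |s| / 2 ≤ ‖z‖) :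
    |(-3 * ⟪z, h⟫_ℝ * ((‖z‖ ^ 2 + q) ^ (5 / 2 : ℝ))⁻¹) * ⟪cross T z, l⟫_ℝ| ≤ 192 * κ₀ * (m₁ + s ^ 2)⁻¹ := by
  obtain ⟨hK1, hK0⟩ := kernel_le_core hm₁ hq ‖z‖ (5 / 2 : ℝ) (by norm_num)
  have hq0 : 0 ≤ q := hm₁.le.trans hq
  have hcz : |⟪cross T z, l⟫_ℝ| ≤ ‖z‖ := by
    calc |⟪cross T z, l⟫_ℝ| ≤ ‖cross T z‖ * ‖l‖ := abs_real_inner_le_norm _ _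
      _ ≤ (‖T‖ * ‖z‖) * 1 := mul_le_mul (norm_cross_le_norm_mul_norm T z) hl (norm_nonneg _)
          ((norm_nonneg _).trans (norm_cross_le_norm_mul_norm T z))
      _ ≤ (1 * ‖z‖) * 1 := by gcongr
      _ = ‖z‖ := by ring
  rw [abs_mul, abs_mul, abs_mul, abs_of_nonneg hK0, show |(-3:ℝ)| = 3 by norm_num]
  have hmain : 3 * |⟪z, h⟫_ℝ| * ((‖z‖ ^ 2 + q) ^ (5 / 2 : ℝ))⁻¹ * |⟪cross T z, l⟫_ℝ| ≤
      3 * (κ₀ * s ^ 2) * (((‖z‖ ^ 2 + q) ^ (5 / 2 : ℝ))⁻¹ * ‖z‖) := by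
    calc _ = 3 * |⟪z, h⟫_ℝ| * (((‖z‖ ^ 2 + q) ^ (5 / 2 : ℝ))⁻¹ * |⟪cross T z, l⟫_ℝ|) := by ring
      _ ≤ _ := by gcongr
  have hms : 0 < m₁ + s ^ 2 := by positivity
  rcases le_or_gt (s ^ 2) m₁ with hs | hs
  · -- `s² ≤ m₁`: `K₅ ‖z‖ ≤ m₁^{-5/2} |s| ≤ m₁^{-5/2} √m₁ = m₁⁻²`, so the term is `≤ 3 κ₀ m₁ · m₁⁻² = 3κ₀/m₁ ≤ 96 κ₀/(m₁ + s²)`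
    have hsa : |s| ≤ Real.sqrt m₁ := by
      rw [← Real.sqrt_sq_eq_abs]; exact Real.sqrt_le_sqrt hs
    have h52 : (m₁ ^ (5 / 2 : ℝ))⁻¹ * Real.sqrt m₁ = (m₁ ^ 2)⁻¹ := by
      rw [Real.sqrt_eq_rpow, show (5 / 2 : ℝ) = 2 + 1 / 2 by norm_num, Real.rpow_add hm₁, Real.rpow_two, mul_inv,
        mul_assoc, inv_mul_cancel₀ (Real.rpow_pos_of_pos hm₁ _).ne', mul_one]
    have hKz : ((‖z‖ ^ 2 + q) ^ (5 / 2 : ℝ))⁻¹ * ‖z‖ ≤ (m₁ ^ 2)⁻¹ := by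
      calc ((‖z‖ ^ 2 + q) ^ (5 / 2 : ℝ))⁻¹ * ‖z‖ ≤ (m₁ ^ (5 / 2 : ℝ))⁻¹ * Real.sqrt m₁ :=
            mul_le_mul hK1 (hzle.trans hsa) (norm_nonneg _) (inv_nonneg.2 (Real.rpow_nonneg hm₁.le _))
        _ = (m₁ ^ 2)⁻¹ := h52
    have hm2 : 0 < m₁ ^ 2 := by positivity
    calc _ ≤ 3 * (κ₀ * s ^ 2) * (((‖z‖ ^ 2 + q) ^ (5 / 2 : ℝ))⁻¹ * ‖z‖) := hmain
      _ ≤ 3 * (κ₀ * m₁) * (m₁ ^ 2)⁻¹ := by gcongr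
      _ = 3 * κ₀ / m₁ := by field_simp
      _ ≤ 192 * κ₀ * (m₁ + s ^ 2)⁻¹ := by
          rw [show 192 * κ₀ * (m₁ + s ^ 2)⁻¹ = 192 * κ₀ / (m₁ + s ^ 2) by rw [div_eq_mul_inv],
            div_le_div_iff₀ hm₁ hms]
          nlinarith [mul_nonneg hκ hm₁.le, mul_nonneg hκ (sq_nonneg s)]
  · -- `s² > m₁`: `K₅ ≤ ‖z‖⁻⁵`, `‖z‖ ≥ |s|/2`
    have hs0 : 0 < |s| := by
      have : 0 < s ^ 2 := hm₁.trans hs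
      exact abs_pos.2 (by rintro rfl; norm_num at this)
    have hzpos : 0 < ‖z‖ := lt_of_lt_of_le (by positivity) hzge
    obtain ⟨-, hK5⟩ := matched_kernel_le_inv_pow hzpos hq0
    have hKz : ((‖z‖ ^ 2 + q) ^ (5 / 2 : ℝ))⁻¹ * ‖z‖ ≤ 16 / s ^ 4 := by
      calc ((‖z‖ ^ 2 + q) ^ (5 / 2 : ℝ))⁻¹ * ‖z‖ ≤ (‖z‖ ^ 5)⁻¹ * ‖z‖ := mul_le_mul_of_nonneg_right hK5 (norm_nonneg _)
        _ = (‖z‖ ^ 4)⁻¹ := by field_simp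
        _ ≤ ((|s| / 2) ^ 4)⁻¹ := inv_anti₀ (pow_pos (by positivity) 4) (pow_le_pow_left₀ (by positivity) hzge 4)
        _ = 16 / s ^ 4 := by
            rw [div_pow, show |s| ^ 4 = s ^ 4 by rw [show (4:ℕ) = 2 * 2 by norm_num, pow_mul, sq_abs, ← pow_mul]]
            rw [inv_div]; norm_num
    have hs2pos : 0 < s ^ 2 := hm₁.trans hs
    have hs4 : 0 < s ^ 4 := by
      have h4 : s ^ 4 = (s ^ 2) ^ 2 := by ring
      rw [h4]; exact pow_pos hs2pos 2
    calc _ ≤ 3 * (κ₀ * s ^ 2) * (((‖z‖ ^ 2 + q) ^ (5 / 2 : ℝ))⁻¹ * ‖z‖) := hmain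
      _ ≤ 3 * (κ₀ * s ^ 2) * (16 / s ^ 4) := by gcongr
      _ = 48 * κ₀ / s ^ 2 := by field_simp; ring
      _ ≤ 192 * κ₀ * (m₁ + s ^ 2)⁻¹ := by
          rw [show 192 * κ₀ * (m₁ + s ^ 2)⁻¹ = 192 * κ₀ / (m₁ + s ^ 2) by rw [div_eq_mul_inv],
            div_le_div_iff₀ hs2pos hms]
          nlinarith [mul_nonneg hκ hm₁.le, mul_nonneg hκ (sq_nonneg s)]

/-- **Region A, turning (`K₃`) correction, matched core.**  With `‖T − t‖ ≤ κ₀|s|`, `‖x‖ ≤ 1`, `|σ| ≤ 1`, `|s|/2 ≤ ‖z‖` (`κ₀ ≥ 0`)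
and a core constant `q ≥ m₁ > 0`: `|2 K₃(q; z) σ ⟪T − t, x⟫| ≤ 32 κ₀ (m₁ + s²)⁻¹`. [folklore] -/
theorem gradIntegrand_turn_le_core {m₁ q : ℝ} (hm₁ : 0 < m₁) (hq : m₁ ≤ q) {T t z x : EuclideanSpace ℝ (Fin 3)} {s κ₀ σ : ℝ}
    (hTt : ‖T - t‖ ≤ κ₀ * |s|) (hx : ‖x‖ ≤ 1) (hσ : |σ| ≤ 1) (hκ : 0 ≤ κ₀) (hzge : |s| / 2 ≤ ‖z‖) :
    |2 * ((‖z‖ ^ 2 + q) ^ (3 / 2 : ℝ))⁻¹ * σ * ⟪T - t, x⟫_ℝ| ≤ 32 * κ₀ * (m₁ + s ^ 2)⁻¹ := by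
  obtain ⟨hK1, hK0⟩ := kernel_le_core hm₁ hq ‖z‖ (3 / 2 : ℝ) (by norm_num)
  have hq0 : 0 ≤ q := hm₁.le.trans hq
  have hin : |⟪T - t, x⟫_ℝ| ≤ κ₀ * |s| := by
    calc |⟪T - t, x⟫_ℝ| ≤ ‖T - t‖ * ‖x‖ := abs_real_inner_le_norm _ _
      _ ≤ κ₀ * |s| * 1 := mul_le_mul hTt hx (norm_nonneg _) ((norm_nonneg _).trans hTt)
      _ = κ₀ * |s| := mul_one _
  rw [abs_mul, abs_mul, abs_mul, abs_of_nonneg hK0, show |(2:ℝ)| = 2 by norm_num]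
  have hmain : 2 * ((‖z‖ ^ 2 + q) ^ (3 / 2 : ℝ))⁻¹ * |σ| * |⟪T - t, x⟫_ℝ| ≤
      2 * ((‖z‖ ^ 2 + q) ^ (3 / 2 : ℝ))⁻¹ * 1 * (κ₀ * |s|) := by gcongr
  have hms : 0 < m₁ + s ^ 2 := by positivity
  rcases le_or_gt (s ^ 2) m₁ with hs | hs
  · have hsa : |s| ≤ Real.sqrt m₁ := by
      rw [← Real.sqrt_sq_eq_abs]; exact Real.sqrt_le_sqrt hs
    have h32 : (m₁ ^ (3 / 2 : ℝ))⁻¹ * Real.sqrt m₁ = m₁⁻¹ := by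
      rw [Real.sqrt_eq_rpow, show (3 / 2 : ℝ) = 1 + 1 / 2 by norm_num, Real.rpow_add hm₁, Real.rpow_one, mul_inv, mul_assoc,
        inv_mul_cancel₀ (Real.rpow_pos_of_pos hm₁ _).ne', mul_one]
    have hKs : ((‖z‖ ^ 2 + q) ^ (3 / 2 : ℝ))⁻¹ * |s| ≤ m₁⁻¹ := by
      calc ((‖z‖ ^ 2 + q) ^ (3 / 2 : ℝ))⁻¹ * |s| ≤ (m₁ ^ (3 / 2 : ℝ))⁻¹ * Real.sqrt m₁ :=
            mul_le_mul hK1 hsa (abs_nonneg _) (inv_nonneg.2 (Real.rpow_nonneg hm₁.le _))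
        _ = m₁⁻¹ := h32
    calc _ ≤ 2 * ((‖z‖ ^ 2 + q) ^ (3 / 2 : ℝ))⁻¹ * 1 * (κ₀ * |s|) := hmain
      _ = 2 * κ₀ * (((‖z‖ ^ 2 + q) ^ (3 / 2 : ℝ))⁻¹ * |s|) := by ring
      _ ≤ 2 * κ₀ * m₁⁻¹ := by gcongr
      _ = 2 * κ₀ / m₁ := by rw [div_eq_mul_inv]
      _ ≤ 32 * κ₀ * (m₁ + s ^ 2)⁻¹ := by
          rw [show 32 * κ₀ * (m₁ + s ^ 2)⁻¹ = 32 * κ₀ / (m₁ + s ^ 2) by rw [div_eq_mul_inv], div_le_div_iff₀ hm₁ hms]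
          nlinarith [mul_nonneg hκ hm₁.le, mul_nonneg hκ (sq_nonneg s)]
  · have hs0 : 0 < |s| := by
      have : 0 < s ^ 2 := hm₁.trans hs
      exact abs_pos.2 (by rintro rfl; norm_num at this)
    have hzpos : 0 < ‖z‖ := lt_of_lt_of_le (by positivity) hzge
    obtain ⟨hK3, -⟩ := matched_kernel_le_inv_pow hzpos hq0
    have hK : ((‖z‖ ^ 2 + q) ^ (3 / 2 : ℝ))⁻¹ ≤ 8 / |s| ^ 3 := by
      calc ((‖z‖ ^ 2 + q) ^ (3 / 2 : ℝ))⁻¹ ≤ (‖z‖ ^ 3)⁻¹ := hK3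
        _ ≤ ((|s| / 2) ^ 3)⁻¹ := inv_anti₀ (by positivity) (pow_le_pow_left₀ (by positivity) hzge 3)
        _ = 8 / |s| ^ 3 := by rw [div_pow, inv_div]; norm_num
    calc _ ≤ 2 * ((‖z‖ ^ 2 + q) ^ (3 / 2 : ℝ))⁻¹ * 1 * (κ₀ * |s|) := hmain
      _ ≤ 2 * (8 / |s| ^ 3) * 1 * (κ₀ * |s|) := by gcongr
      _ = 16 * κ₀ / |s| ^ 2 := by field_simp; ring
      _ = 16 * κ₀ / s ^ 2 := by rw [sq_abs]
      _ ≤ 32 * κ₀ * (m₁ + s ^ 2)⁻¹ := by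
          rw [show 32 * κ₀ * (m₁ + s ^ 2)⁻¹ = 32 * κ₀ / (m₁ + s ^ 2) by rw [div_eq_mul_inv],
            div_le_div_iff₀ (hm₁.trans hs) hms]
          nlinarith [mul_nonneg hκ hm₁.le, mul_nonneg hκ (sq_nonneg s)]

/-! ### Region B (far from the base point): core-free Cauchy majorant -/

/-- **Region B, matched core (any `q ≥ 0`).**  If `‖T‖ ≤ 1`, `D₁ ≤ ‖z‖` and `c₁|s| − A₁ ≤ ‖z‖` (`c₁, D₁ > 0`, `A₁ ≥ 0`), then
`‖z‖⁻³ ≤ (2/D₁³)(1 + (c₁ s/(D₁ + A₁))²)⁻¹`, the whole derivative integrand has norm `≤ (8‖v‖/D₁³)(1 + (c₁ s/(D₁ + A₁))²)⁻¹` and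
`K₃(q; z) ≤ (2/D₁³)(1 + (c₁ s/(D₁ + A₁))²)⁻¹`. [folklore] -/
theorem gradIntegrand_far_le_core {q : ℝ} (hq0 : 0 ≤ q) {T z v : EuclideanSpace ℝ (Fin 3)} {s c₁ D₁ A₁ : ℝ} (hT : ‖T‖ ≤ 1)
    (hc₁ : 0 < c₁) (hD₁ : 0 < D₁) (hA₁ : 0 ≤ A₁) (hfar : D₁ ≤ ‖z‖) (hesc : c₁ * |s| - A₁ ≤ ‖z‖) :
    (‖z‖ ^ 3)⁻¹ ≤ 2 / D₁ ^ 3 * (1 + (c₁ * s / (D₁ + A₁)) ^ 2)⁻¹ ∧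
    ‖(-3 * ⟪z, v⟫_ℝ * ((‖z‖ ^ 2 + q) ^ (5 / 2 : ℝ))⁻¹) • cross T z + ((‖z‖ ^ 2 + q) ^ (3 / 2 : ℝ))⁻¹ • cross T v‖ ≤
      8 * ‖v‖ / D₁ ^ 3 * (1 + (c₁ * s / (D₁ + A₁)) ^ 2)⁻¹ ∧
    ((‖z‖ ^ 2 + q) ^ (3 / 2 : ℝ))⁻¹ ≤ 2 / D₁ ^ 3 * (1 + (c₁ * s / (D₁ + A₁)) ^ 2)⁻¹ := by
  have hzpos : 0 < ‖z‖ := lt_of_lt_of_le hD₁ hfar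
  -- the core-free cube bound is the unit-core lemma's first conjunct
  obtain ⟨hcube, -, -⟩ := gradIntegrand_far_le (v := v) hT hc₁ hD₁ hA₁ hfar hesc
  have h1 := matched_gradIntegrand_norm_le hq0 (v := v) hT hzpos
  obtain ⟨hK3, -⟩ := matched_kernel_le_inv_pow hzpos hq0
  refine ⟨hcube, h1.trans ?_, hK3.trans hcube⟩
  calc 4 * ‖v‖ / ‖z‖ ^ 3 = 4 * ‖v‖ * (‖z‖ ^ 3)⁻¹ := by rw [div_eq_mul_inv]
    _ ≤ 4 * ‖v‖ * (2 / D₁ ^ 3 * (1 + (c₁ * s / (D₁ + A₁)) ^ 2)⁻¹) := mul_le_mul_of_nonneg_left hcube (by positivity)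
    _ = 8 * ‖v‖ / D₁ ^ 3 * (1 + (c₁ * s / (D₁ + A₁)) ^ 2)⁻¹ := by ring

/-! ### The core-scaled two-region majorant and its integral -/

/-- `∫ (m₁ + (u − c)²)⁻¹ du = π/√m₁` for `m₁ > 0` (integrable). [folklore] -/
theorem integral_inv_core_add_sq {m₁ : ℝ} (hm₁ : 0 < m₁) (c : ℝ) :
    Integrable (fun u : ℝ => (m₁ + (u - c) ^ 2)⁻¹) ∧ ∫ u : ℝ, (m₁ + (u - c) ^ 2)⁻¹ = Real.pi / Real.sqrt m₁ := by
  have ha : 0 < Real.sqrt m₁ := Real.sqrt_pos.2 hm₁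
  set k : ℝ := (Real.sqrt m₁)⁻¹ with hk
  have hkpos : 0 < k := inv_pos.2 ha
  have hsq : Real.sqrt m₁ * Real.sqrt m₁ = m₁ := Real.mul_self_sqrt hm₁.le
  -- `(m₁ + x²)⁻¹ = m₁⁻¹ (1 + (k x)²)⁻¹`
  have hid : ∀ x : ℝ, (m₁ + x ^ 2)⁻¹ = m₁⁻¹ * (1 + (k * x) ^ 2)⁻¹ := by
    intro x
    have h1 : 1 + (k * x) ^ 2 = m₁⁻¹ * (m₁ + x ^ 2) := by
      rw [hk]; field_simp; nlinarith [hsq]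
    rw [h1, mul_inv, inv_inv, ← mul_assoc, inv_mul_cancel₀ hm₁.ne', one_mul]
  have hB0 : Integrable (fun u : ℝ => (1 + (k * u) ^ 2)⁻¹) := integrable_inv_one_add_sq.comp_mul_left' hkpos.ne'
  have hB : Integrable (fun u : ℝ => (1 + (k * (u - c)) ^ 2)⁻¹) := hB0.comp_sub_right c
  have hfun : (fun u : ℝ => (m₁ + (u - c) ^ 2)⁻¹) = fun u => m₁⁻¹ * (1 + (k * (u - c)) ^ 2)⁻¹ := funext fun u => hid (u - c)
  rw [hfun]
  refine ⟨hB.const_mul _, ?_⟩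
  rw [integral_const_mul, integral_sub_right_eq_self (fun u : ℝ => (1 + (k * u) ^ 2)⁻¹) c,
    Measure.integral_comp_mul_left (fun y : ℝ => (1 + y ^ 2)⁻¹), integral_univ_inv_one_add_sq, smul_eq_mul,
    abs_of_pos (inv_pos.2 hkpos), hk, inv_inv]
  field_simp
  rw [Real.sq_sqrt hm₁.le]

/-- Integral of the core-scaled two-region majorant `C_A (m₁ + (u − c)²)⁻¹ + C_B (1 + (k(u − c))²)⁻¹` (`m₁, k > 0`): integrable, with
integral `C_A π/√m₁ + C_B π/k`. [folklore] -/
theorem coreRegion_majorant_integral {m₁ : ℝ} (hm₁ : 0 < m₁) (c CA CB : ℝ) {k : ℝ} (hk : 0 < k) :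
    Integrable (fun u : ℝ => CA * (m₁ + (u - c) ^ 2)⁻¹ + CB * (1 + (k * (u - c)) ^ 2)⁻¹) ∧
    ∫ u : ℝ, (CA * (m₁ + (u - c) ^ 2)⁻¹ + CB * (1 + (k * (u - c)) ^ 2)⁻¹) = CA * (Real.pi / Real.sqrt m₁) + CB * (Real.pi / k) := by
  obtain ⟨hA, hAv⟩ := integral_inv_core_add_sq hm₁ c
  have hB0 : Integrable (fun u : ℝ => (1 + (k * u) ^ 2)⁻¹) := integrable_inv_one_add_sq.comp_mul_left' hk.ne'
  have hB : Integrable (fun u : ℝ => (1 + (k * (u - c)) ^ 2)⁻¹) := hB0.comp_sub_right c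
  have hBv : ∫ u : ℝ, (1 + (k * (u - c)) ^ 2)⁻¹ = Real.pi / k := by
    rw [integral_sub_right_eq_self (fun u : ℝ => (1 + (k * u) ^ 2)⁻¹) c,
      Measure.integral_comp_mul_left (fun y : ℝ => (1 + y ^ 2)⁻¹), integral_univ_inv_one_add_sq, smul_eq_mul,
      abs_of_pos (inv_pos.2 hk)]
    ring
  refine ⟨(hA.const_mul CA).add (hB.const_mul CB), ?_⟩
  rw [integral_add (hA.const_mul CA) (hB.const_mul CB), integral_const_mul, integral_const_mul, hAv, hBv]

/-- Pointwise domination by the core-scaled two-region majorant: if a real quantity is `≤ a (m₁ + s²)⁻¹` whenever `|s| ≤ S₁` and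
`≤ b (1 + (k s)²)⁻¹` whenever `S₁ ≤ |s|` (`a, b ≥ 0`, `m₁ > 0`), it is `≤ a (m₁ + s²)⁻¹ + b (1 + (k s)²)⁻¹`. [folklore] -/
theorem coreRegion_dominate {m₁ q s S₁ a b k : ℝ} (hm₁ : 0 < m₁) (ha : 0 ≤ a) (hb : 0 ≤ b)
    (hAreg : |s| ≤ S₁ → q ≤ a * (m₁ + s ^ 2)⁻¹) (hBreg : S₁ ≤ |s| → q ≤ b * (1 + (k * s) ^ 2)⁻¹) :
    q ≤ a * (m₁ + s ^ 2)⁻¹ + b * (1 + (k * s) ^ 2)⁻¹ := by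
  have h1 : 0 ≤ a * (m₁ + s ^ 2)⁻¹ := mul_nonneg ha (inv_nonneg.2 (by positivity))
  have h2 : 0 ≤ b * (1 + (k * s) ^ 2)⁻¹ := by positivity
  rcases le_total |s| S₁ with hs | hs
  · linarith [hAreg hs]
  · linarith [hBreg hs]

end Summit.NavierStokesRegularity.NavierStokesRegularity.Theorems.MatchedKernel
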